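import Mathlib.Algebra.MvPolynomial.CommRing
import Mathlib.Data.Finsupp.Weight
import Mathlib.RingTheory.Ideal.Span
import Mathlib.Tactic.LinearCombination
import Mathlib.Tactic.Ring
import HarnessLib

/-!
# Venture HSemireg — the three-sheet crossing germ `V(ac, ad, bc)`: no first-order smoothing at the curve

Elementary algebra behind THEOREM CC-D-Γ («hanging sheets») of the computation cell `pub-hsemireg`
(`widen/W1/CLEAN-COMPONENT-THEOREM-w1tw1.md` §25, seat w1-tw-1, W1). At a general point of a curve
`Γ` along which a support piece `Y` has two normally crossing smooth branches `Y₊ = ⟨c,d⟩`,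
`Y₋ = ⟨a,b⟩` and a smooth partner `Y' = ⟨b,d⟩` passes through both local sheets of the contact
surface, the reduced union is `V(ac, ad, bc) × Γ` — the three coordinate planes of the path
`a – b – d – c` in `𝔸⁴`. A first-order embedded deformation perturbs the generators
`(ac, ad, bc) ↦ (ac + εf₁, ad + εf₂, bc + εf₃)` and is flat iff the two linear syzygies lift, i.e.
iff `d f₁ − c f₂ ∈ I` and `b f₁ − a f₃ ∈ I`, `I = (ac, ad, bc)`.

* `coeff_eq_zero_of_mem_span` — every element of `I` has all coefficients of total degree `≤ 1`
  equal to zero (`I` is generated in degree `2`);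
* `constantCoeff_eq_zero_of_syzygies` — **if `d f₁ − c f₂ ∈ I` and `b f₁ − a f₃ ∈ I` then
  `f₁(0) = f₂(0) = f₃(0) = 0`**: the smoothing parameters of BOTH crossing lines (the `b`-axis
  `Y₋ ∩ Y'` and the `d`-axis `Y₊ ∩ Y'`) VANISH at the point of `Γ` — no crossing of the three-sheet
  germ is smoothed to first order at the curve (read off by the coefficient-of-`c`, -`d`, -`a`
  functionals, which kill `I`);
* `syzygies_of_b_pow`, `syzygies_of_d_pow` — the perturbations `(0, b^{j+1}, 0)` and
  `(0, 0, d^{m+1})` DO satisfy the two conditions (these span `T¹`);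
* `not_syzygy_constant` — `(0, 1, 0)` does not (over a nontrivial ring): `−c ∉ I`;
* `relation₁`, `relation₂` — the two syzygies lift identically over the explicit all-order family
  `(ac − βδ, ad + bβ, bc + dδ)` (LEMMA Γ-3 of the record: every flat one-parameter deformation of
  the germ has this form in suitable coordinates, so the smoothing functions `−bβ`, `−dδ` of the two
  crossings are divisible by the equation of `Γ` in the sheet — no pole, a forced zero);
* `square_example` — in the four-sheet square `V(ad, bc)` (a complete intersection) the flat family
  `(ad + tc, bc + t)` has `b·(ad + tc) = abd − t²` on `bc + t = 0`: the opposite crossing is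
  smoothed at order two with the coefficient `1/b`, a simple pole along `Γ` (the honest residual
  (B) of §25).

HONEST FRAMING. Commutative algebra in `R[a,b,c,d]` only; Lean index of the local algebra of a
NEGATIVE structure theorem (a necessary condition) of the cell record. No scheme, sheaf, abelian
variety or semiregularity map appears; nothing here says that HC, HC_CM or HC_AV holds, and nothing
here is a new case of anything.
-/

open MvPolynomial

namespace Summit.Ventures.HSemireg

namespace ThreeSheet

universe u

variable {R : Type u} [CommRing R]

/-- The coefficient of a monomial of total degree `≤ 1` of `X i * X j * q` vanishes.
[cite: Hartshorne2010, §3] -/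
theorem coeff_X_mul_X_mul_eq_zero (i j : Fin 4) (q : MvPolynomial (Fin 4) R)
    (m : Fin 4 →₀ ℕ) (hm : m.degree ≤ 1) : coeff m (X i * X j * q) = 0 := by
  classical
  rw [mul_assoc, coeff_X_mul']
  split_ifs with hi
  · rw [coeff_X_mul']
    split_ifs with hj
    · exfalso
      -- `i ∈ m.support` and `j ∈ (m - single i 1).support` force `degree m ≥ 2`
      have hi1 : 1 ≤ m i := by
        rw [Finsupp.mem_support_iff] at hi; omega
      have hj1 : 1 ≤ (m - Finsupp.single i 1 : Fin 4 →₀ ℕ) j := by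
        rw [Finsupp.mem_support_iff] at hj; omega
      have hsum : m = (m - Finsupp.single i 1) + Finsupp.single i 1 := by
        ext k
        simp only [Finsupp.coe_add, Finsupp.coe_tsub, Pi.add_apply, Pi.sub_apply,
          Finsupp.single_apply]
        split_ifs with h
        · subst h; omega
        · omega
      have hdeg : m.degree = (m - Finsupp.single i 1 : Fin 4 →₀ ℕ).degree + 1 := by
        conv_lhs => rw [hsum]
        rw [map_add, Finsupp.degree_single]
      have hle : (m - Finsupp.single i 1 : Fin 4 →₀ ℕ) j ≤
          (m - Finsupp.single i 1 : Fin 4 →₀ ℕ).degree :=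
        Finsupp.le_degree j _
      omega
    · rfl
  · rfl

/-- **`I = (ac, ad, bc)` is generated in degree 2**: every element of `I` has vanishing
coefficients in total degree `≤ 1` (with `a = X 0, b = X 1, c = X 2, d = X 3`).
[cite: Hartshorne2010, §3] -/
theorem coeff_eq_zero_of_mem_span (p : MvPolynomial (Fin 4) R)
    (hp : p ∈ Ideal.span ({X 0 * X 2, X 0 * X 3, X 1 * X 2} : Set (MvPolynomial (Fin 4) R)))
    (m : Fin 4 →₀ ℕ) (hm : m.degree ≤ 1) : coeff m p = 0 := by
  classical
  rw [Ideal.span, Submodule.mem_span_insert] at hp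
  obtain ⟨r₁, p₁, hp₁, rfl⟩ := hp
  rw [Submodule.mem_span_insert] at hp₁
  obtain ⟨r₂, p₂, hp₂, rfl⟩ := hp₁
  rw [Submodule.mem_span_singleton] at hp₂
  obtain ⟨r₃, rfl⟩ := hp₂
  simp only [smul_eq_mul, coeff_add]
  have h1 : coeff m (r₁ * (X 0 * X 2)) = 0 := by
    rw [show r₁ * (X 0 * X 2) = X 0 * X 2 * r₁ by ring]
    exact coeff_X_mul_X_mul_eq_zero 0 2 r₁ m hm
  have h2 : coeff m (r₂ * (X 0 * X 3)) = 0 := by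
    rw [show r₂ * (X 0 * X 3) = X 0 * X 3 * r₂ by ring]
    exact coeff_X_mul_X_mul_eq_zero 0 3 r₂ m hm
  have h3 : coeff m (r₃ * (X 1 * X 2)) = 0 := by
    rw [show r₃ * (X 1 * X 2) = X 1 * X 2 * r₃ by ring]
    exact coeff_X_mul_X_mul_eq_zero 1 2 r₃ m hm
  rw [h1, h2, h3]; ring

/-- The coefficient-of-`X s` functional reads the constant term off `X s * f` and kills `X s' * g`
for `s' ≠ s`. [cite: Hartshorne2010, §3] -/
theorem coeff_single_X_mul (s s' : Fin 4) (f : MvPolynomial (Fin 4) R) :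
    coeff (Finsupp.single s 1) (X s' * f) = if s' = s then constantCoeff f else 0 := by
  classical
  rw [coeff_X_mul']
  by_cases h : s' = s
  · subst h
    have hs : s' ∈ (Finsupp.single s' 1 : Fin 4 →₀ ℕ).support := by
      rw [Finsupp.mem_support_iff, Finsupp.single_eq_same]; exact one_ne_zero
    rw [if_pos hs, if_pos rfl, tsub_self, constantCoeff_eq]
  · have hs : s' ∉ (Finsupp.single s 1 : Fin 4 →₀ ℕ).support := by
      rw [Finsupp.mem_support_iff, not_not, Finsupp.single_eq_of_ne h]
    rw [if_neg hs, if_neg h]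

/-- **THEOREM (no first-order smoothing at the curve).** If the perturbation `(f₁, f₂, f₃)` of the
generators `(ac, ad, bc)` satisfies the two lifted-syzygy conditions `d f₁ − c f₂ ∈ I`,
`b f₁ − a f₃ ∈ I` (flatness over the dual numbers), then `f₁, f₂, f₃` all have ZERO constant
term: the `T¹` of the three-sheet germ has no constant term on either crossing line — the snc
smoothing parameters vanish at the point of `Γ` (CC note §25, LEMMA Γ-2, degree-one heart).
[cite: Hartshorne2010, §3] -/
theorem constantCoeff_eq_zero_of_syzygies (f₁ f₂ f₃ : MvPolynomial (Fin 4) R)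
    (h₁ : X 3 * f₁ - X 2 * f₂ ∈
      Ideal.span ({X 0 * X 2, X 0 * X 3, X 1 * X 2} : Set (MvPolynomial (Fin 4) R)))
    (h₂ : X 1 * f₁ - X 0 * f₃ ∈
      Ideal.span ({X 0 * X 2, X 0 * X 3, X 1 * X 2} : Set (MvPolynomial (Fin 4) R))) :
    constantCoeff f₁ = 0 ∧ constantCoeff f₂ = 0 ∧ constantCoeff f₃ = 0 := by
  classical
  have hdeg : ∀ s : Fin 4, (Finsupp.single s 1 : Fin 4 →₀ ℕ).degree ≤ 1 := by
    intro s; simp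
  refine ⟨?_, ?_, ?_⟩
  · -- coefficient of `d` in `d f₁ - c f₂`
    have e := coeff_eq_zero_of_mem_span _ h₁ (Finsupp.single 3 1) (hdeg 3)
    rw [coeff_sub, coeff_single_X_mul, coeff_single_X_mul, if_pos rfl,
      if_neg (by decide)] at e
    simpa using e
  · -- coefficient of `c` in `d f₁ - c f₂`
    have e := coeff_eq_zero_of_mem_span _ h₁ (Finsupp.single 2 1) (hdeg 2)
    rw [coeff_sub, coeff_single_X_mul, coeff_single_X_mul, if_neg (by decide),
      if_pos rfl] at e
    simpa using e
  · -- coefficient of `a` in `b f₁ - a f₃`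
    have e := coeff_eq_zero_of_mem_span _ h₂ (Finsupp.single 0 1) (hdeg 0)
    rw [coeff_sub, coeff_single_X_mul, coeff_single_X_mul, if_neg (by decide),
      if_pos rfl] at e
    simpa using e

/-- The perturbation `(0, b^{j+1}, 0)` satisfies both conditions: `d·0 − c·b^{j+1} = −b^j·(bc) ∈ I`,
`b·0 − a·0 = 0`. (These and their `d`-twins span `T¹` of the germ.) [cite: Hartshorne2010, §3] -/
theorem syzygies_of_b_pow (j : ℕ) :
    (X 3 * 0 - X 2 * X 1 ^ (j + 1) ∈
        Ideal.span ({X 0 * X 2, X 0 * X 3, X 1 * X 2} : Set (MvPolynomial (Fin 4) R))) ∧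
      (X 1 * 0 - X 0 * 0 ∈
        Ideal.span ({X 0 * X 2, X 0 * X 3, X 1 * X 2} : Set (MvPolynomial (Fin 4) R))) := by
  refine ⟨?_, by simp⟩
  have hmem : (X 1 * X 2 : MvPolynomial (Fin 4) R) ∈
      Ideal.span ({X 0 * X 2, X 0 * X 3, X 1 * X 2} : Set (MvPolynomial (Fin 4) R)) :=
    Ideal.subset_span (by simp)
  have : (X 3 * 0 - X 2 * X 1 ^ (j + 1) : MvPolynomial (Fin 4) R) = (-X 1 ^ j) * (X 1 * X 2) := by
    ring
  rw [this]
  exact Ideal.mul_mem_left _ _ hmem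

/-- The perturbation `(0, 0, d^{m+1})` satisfies both conditions: `d·0 − c·0 = 0`,
`b·0 − a·d^{m+1} = −d^m·(ad) ∈ I`. [cite: Hartshorne2010, §3] -/
theorem syzygies_of_d_pow (m : ℕ) :
    (X 3 * 0 - X 2 * 0 ∈
        Ideal.span ({X 0 * X 2, X 0 * X 3, X 1 * X 2} : Set (MvPolynomial (Fin 4) R))) ∧
      (X 1 * 0 - X 0 * X 3 ^ (m + 1) ∈
        Ideal.span ({X 0 * X 2, X 0 * X 3, X 1 * X 2} : Set (MvPolynomial (Fin 4) R))) := by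
  refine ⟨by simp, ?_⟩
  have hmem : (X 0 * X 3 : MvPolynomial (Fin 4) R) ∈
      Ideal.span ({X 0 * X 2, X 0 * X 3, X 1 * X 2} : Set (MvPolynomial (Fin 4) R)) :=
    Ideal.subset_span (by simp)
  have : (X 1 * 0 - X 0 * X 3 ^ (m + 1) : MvPolynomial (Fin 4) R) = (-X 3 ^ m) * (X 0 * X 3) := by
    ring
  rw [this]
  exact Ideal.mul_mem_left _ _ hmem

/-- **The constant smoothing `(0, 1, 0)` is NOT flat**: `d·0 − c·1 = −c ∉ I` over a nontrivial
ring (the coefficient of `c` is `−1 ≠ 0`). Geometrically: smoothing `Y₋ ∪ Y'` to a quadric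
disconnects the hanging sheet `Y₊`. [cite: Hartshorne2010, §3] -/
theorem not_syzygy_constant [Nontrivial R] :
    (X 3 * 0 - X 2 * 1 : MvPolynomial (Fin 4) R) ∉
      Ideal.span ({X 0 * X 2, X 0 * X 3, X 1 * X 2} : Set (MvPolynomial (Fin 4) R)) := by
  classical
  intro h
  have e := coeff_eq_zero_of_mem_span _ h (Finsupp.single 2 1) (by simp)
  rw [mul_zero, mul_one, zero_sub, coeff_neg, coeff_X_same, neg_eq_zero] at e
  exact one_ne_zero e

/-- **The first relation lifts over the all-order family `(ac − βδ, ad + bβ, bc + dδ)`**: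
`d·(ac − βδ) − c·(ad + bβ) + β·(bc + dδ) = 0` identically (LEMMA Γ-3: hence the family is flat
over `ℂ{t}` for every `β ∈ tℂ{b,s,t}`, `δ ∈ tℂ{d,s,t}`). [cite: Matsumura1987, Thm. 22.3] -/
theorem relation₁ (a b c d β δ : R) :
    d * (a * c - β * δ) - c * (a * d + b * β) + β * (b * c + d * δ) = 0 := by
  ring

/-- **The second relation lifts**: `b·(ac − βδ) + δ·(ad + bβ) − a·(bc + dδ) = 0` identically.
[cite: Matsumura1987, Thm. 22.3] -/
theorem relation₂ (a b c d β δ : R) :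
    b * (a * c - β * δ) + δ * (a * d + b * β) - a * (b * c + d * δ) = 0 := by
  ring

/-- **The square example (honest residual (B))**: in the complete intersection `V(ad, bc)` the flat
family `(ad + tc, bc + t)` satisfies `b·(ad + tc) = abd − t²` wherever `bc + t = 0` — along the
`b`-axis crossing (`b` a unit) the smoothing function is `t²/b`: order two, a SIMPLE POLE along
`Γ`, fed by the order-one smoothing of the adjacent crossings. [cite: Hartshorne2010, §3] -/
theorem square_example (a b c d t : R) (h : b * c + t = 0) :
    b * (a * d + t * c) = a * b * d - t ^ 2 := by
  linear_combination t * h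

end ThreeSheet

end Summit.Ventures.HSemireg
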